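import Literature.AnabelianGeometry.SemiGraphs.InducedAlong
import Literature.AnabelianGeometry.SemiGraphs.SemiGraphLocalMap

/-!
# Functoriality of the localizations `𝒢[v]`, `𝒢[e]` in morphisms of semi-graphs of anabelioids ([SemiAnbd] §4 Def 4.1 (iv)) — merge step M4, part 3b

Mochizuki, *Semi-graphs of anabelioids*, Publ. RIMS **42** (2006), §4 Def 4.1 (iv) p.51 ("each of
the induced morphisms `H[c] → H'[c']` [where `c` is a component of `H` that maps to a component
`c'` of `H'`]") (kurims `paper:url-f33ace170ff4`). [cite: MochizukiSemiAnbd2006, Def 4.1 (iv), p. 51]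

CONSTRUCTION (L3 bridge, step M4 part 3b; cell ruling abc-iut-L3-lead 2026-08-25T20:36Z), over
`InducedAlong.lean` (pull-back of a semi-graph of anabelioids along a morphism of semi-graphs) and
`SemiGraphLocalMap.lean` (the underlying maps `𝔾[v] → ℍ[f v]`, `𝔾[e] → ℍ[f e]`):

* `HomOver.inducedAlongSquare` — a 1-morphism `φ : 𝒢 → ℋ` over `f` and a commutative square of
  semi-graphs `ι₁ ≫ f = κ ≫ ι₂` induce a 1-morphism `𝒢_{H₁} → ℋ_{H₂}` over `κ` (constituent
  morphisms those of `φ`, read along the equalities the square provides; 2-cells pasted from `φ_b`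
  over arbitrary presentations, `squareCell`);
* `HomOver.atVertexMap φ v : 𝒢[v] → ℋ[f v]`, `HomOver.atEdgeMap φ e : 𝒢[e] → ℋ[f e]` — the induced
  morphisms of Def 4.1 (iv) — and their local openness when `φ` is locally open.

Pending (M4 part 3c): the commuting squares with `𝒢[v] → 𝒢` as 2-isomorphisms / equalities in the
ambient category `SgA`, functoriality up to 2-isomorphism, total aloofness of localizations.
Nothing printed is asserted.
-/

namespace Literature.AnabelianGeometry.SemiGraphs

open CategoryTheory Literature.AnabelianGeometry.Anabelioids

universe v₁ u₁ u

namespace SemiGraphOfAnabelioids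

variable {𝒢 ℋ : SemiGraphOfAnabelioids.{v₁, u₁, u}} {f : 𝒢.graph ⟶ ℋ.graph}

/-- Reading an edge component `φ_e : 𝒢_e → ℋ_{e₁}` (any presentation `f e = e₁`) as the canonical
one followed by the transport `idE`: the identity at the canonical presentation.
[cite: MochizukiSemiAnbd2006, Rmk 2.4.2, p. 26] -/
noncomputable def HomOver.φEReindexIso (φ : HomOver 𝒢 ℋ f) (e : 𝒢.graph.Edge) (e₁ : ℋ.graph.Edge)
    (h₁ : f.edgeMap e = e₁) :
    ((φ.φE e (f.edgeMap e) rfl).comp (ℋ.idE (f.edgeMap e) e₁ h₁)).pullback ≅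
      (φ.φE e e₁ h₁).pullback := by
  subst h₁; exact Functor.leftUnitor _

/-- The 2-cell of the induced 1-morphism over a commutative square, over ARBITRARY presentations
(all equalities between branches / vertices / edges as hypotheses; the branch morphisms `P`, `Q₀`,
`Q` and the 2-cell `α₀` — in every use `φ_b` — as parameters; pasted from `α₀` after `subst`).
[cite: MochizukiSemiAnbd2006, Def 4.1 (iv), p. 51] -/
noncomputable def HomOver.squareCell (φ : HomOver 𝒢 ℋ f)
    (β₁ : 𝒢.graph.Branch) (v₁ : 𝒢.graph.Vertex)
    (P : Anabelioids.Hom (𝒢.E (𝒢.graph.edgeOf β₁)) (𝒢.V v₁))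
    (E₀ : 𝒢.graph.Edge) (p₁ : E₀ = 𝒢.graph.edgeOf β₁)
    (β₂ : ℋ.graph.Branch) (v₂ : ℋ.graph.Vertex) (hβ : f.branchMap β₁ = β₂)
    (hv : f.vertexMap v₁ = v₂)
    (E₀' : ℋ.graph.Edge) (p₂ : E₀' = ℋ.graph.edgeOf β₂) (q : f.edgeMap E₀ = E₀')
    (q₁ : f.edgeMap (𝒢.graph.edgeOf β₁) = ℋ.graph.edgeOf (f.branchMap β₁))
    (Q₀ : Anabelioids.Hom (ℋ.E (ℋ.graph.edgeOf (f.branchMap β₁))) (ℋ.V (f.vertexMap v₁)))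
    (Q : Anabelioids.Hom (ℋ.E (ℋ.graph.edgeOf β₂)) (ℋ.V v₂)) (hQ : HEq Q₀ Q)
    (α₀ : (φ.φV v₁).pullback ⋙ P.pullback ≅
      Q₀.pullback ⋙ (φ.φE (𝒢.graph.edgeOf β₁) (ℋ.graph.edgeOf (f.branchMap β₁)) q₁).pullback) :
    ((φ.φV v₁).comp (ℋ.idV (f.vertexMap v₁) v₂ hv)).pullback ⋙
        ((𝒢.idE E₀ _ p₁).comp P).pullback ≅
      ((ℋ.idE E₀' _ p₂).comp Q).pullback ⋙ (φ.φE E₀ E₀' q).pullback := by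
  subst hβ; subst hv; subst p₁; subst p₂; cases hQ
  exact Functor.isoWhiskerRight (φ.φV v₁).pullback.leftUnitor _ ≪≫
    Functor.isoWhiskerLeft (φ.φV v₁).pullback P.pullback.rightUnitor ≪≫ α₀ ≪≫
    Functor.isoWhiskerRight Q₀.pullback.rightUnitor.symm _

variable {H₁ H₂ : SemiGraph.{u}}

/-- **The 1-morphism induced over a commutative square of semi-graphs** `ι₁ ≫ f = κ ≫ ι₂` by a
1-morphism `φ : 𝒢 → ℋ` over `f`: `𝒢_{H₁} → ℋ_{H₂}` over `κ` (Def 4.1 (iv) "the induced morphisms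
`H[c] → H'[c']`"). [cite: MochizukiSemiAnbd2006, Def 4.1 (iv), p. 51] -/
noncomputable def HomOver.inducedAlongSquare (φ : HomOver 𝒢 ℋ f) (ι₁ : H₁ ⟶ 𝒢.graph)
    (ι₂ : H₂ ⟶ ℋ.graph) (κ : H₁ ⟶ H₂) (r : ι₁ ≫ f = κ ≫ ι₂) :
    HomOver (𝒢.inducedAlong ι₁) (ℋ.inducedAlong ι₂) κ where
  φV w := (φ.φV (ι₁.vertexMap w)).comp
    (ℋ.idV (f.vertexMap (ι₁.vertexMap w)) (ι₂.vertexMap (κ.vertexMap w))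
      (congrArg (fun t : H₁ ⟶ ℋ.graph => t.vertexMap w) r))
  φE e e' h := φ.φE (ι₁.edgeMap e) (ι₂.edgeMap e')
    ((congrArg (fun t : H₁ ⟶ ℋ.graph => t.edgeMap e) r).trans (congrArg ι₂.edgeMap h))
  φB c w hc :=
    φ.squareCell (ι₁.branchMap c) (ι₁.vertexMap w)
      (𝒢.pull (ι₁.branchMap c) (ι₁.vertexMap w) (ι₁.abuts_branchMap c w hc))
      (ι₁.edgeMap (H₁.edgeOf c)) (ι₁.edgeOf_branchMap c).symm
      (ι₂.branchMap (κ.branchMap c)) (ι₂.vertexMap (κ.vertexMap w))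
      (congrArg (fun t : H₁ ⟶ ℋ.graph => t.branchMap c) r)
      (congrArg (fun t : H₁ ⟶ ℋ.graph => t.vertexMap w) r)
      (ι₂.edgeMap (H₂.edgeOf (κ.branchMap c))) (ι₂.edgeOf_branchMap (κ.branchMap c)).symm
      ((congrArg (fun t : H₁ ⟶ ℋ.graph => t.edgeMap (H₁.edgeOf c)) r).trans
        (congrArg ι₂.edgeMap (κ.edgeOf_branchMap c).symm))
      (f.edgeOf_branchMap (ι₁.branchMap c)).symm
      (ℋ.pull (f.branchMap (ι₁.branchMap c)) (f.vertexMap (ι₁.vertexMap w))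
        (f.abuts_branchMap _ _ (ι₁.abuts_branchMap c w hc)))
      (ℋ.pull (ι₂.branchMap (κ.branchMap c)) (ι₂.vertexMap (κ.vertexMap w))
        (ι₂.abuts_branchMap _ _ (κ.abuts_branchMap c w hc)))
      (pull_heq _ _ (congrArg (fun t : H₁ ⟶ ℋ.graph => t.branchMap c) r) _ _
        (congrArg (fun t : H₁ ⟶ ℋ.graph => t.vertexMap w) r) _ _)
      (φ.φB (ι₁.branchMap c) (ι₁.vertexMap w) (ι₁.abuts_branchMap c w hc))

/-! ### Local openness of the induced 1-morphism -/

/-- Open image of `π₁` is unchanged by post-composing with a transported vertex identity.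
[cite: MochizukiSemiAnbd2006, Def 2.2 (ii), p. 24] -/
theorem isOpen_range_pi1Map_comp_idV {A : Type u₁} [Category.{v₁} A] (v v' : ℋ.graph.Vertex)
    (h : v = v') (P : Anabelioids.Hom A (ℋ.V v)) (F : A ⥤ FintypeCat.{v₁})
    (hP : IsOpen (Set.range (pi1Map P.pullback F))) :
    IsOpen (Set.range (pi1Map (P.comp (ℋ.idV v v' h)).pullback F)) := by
  subst h; exact hP

/-- Open image of `π₁` for an edge component at ANY presentation of the image edge.
[cite: MochizukiSemiAnbd2006, Def 2.2 (ii), p. 24] -/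
theorem isOpen_range_pi1Map_φE (φ : HomOver 𝒢 ℋ f) (e : 𝒢.graph.Edge) (e₁ : ℋ.graph.Edge)
    (h₁ : f.edgeMap e = e₁) (F : 𝒢.E e ⥤ FintypeCat.{v₁})
    (h : IsOpen (Set.range (pi1Map (φ.φE e (f.edgeMap e) rfl).pullback F))) :
    IsOpen (Set.range (pi1Map (φ.φE e e₁ h₁).pullback F)) := by
  subst h₁; exact h

/-- The induced 1-morphism over a commutative square is locally open when `φ` is.
[cite: MochizukiSemiAnbd2006, Def 2.2 (ii), p. 24] -/
theorem HomOver.inducedAlongSquare_isLocallyOpen (φ : HomOver 𝒢 ℋ f) (ι₁ : H₁ ⟶ 𝒢.graph)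
    (ι₂ : H₂ ⟶ ℋ.graph) (κ : H₁ ⟶ H₂) (r : ι₁ ≫ f = κ ≫ ι₂) (hφ : φ.toHom.IsLocallyOpen) :
    (φ.inducedAlongSquare ι₁ ι₂ κ r).toHom.IsLocallyOpen := by
  refine ⟨fun w F _ => ?_, fun e F _ => ?_⟩
  · exact isOpen_range_pi1Map_comp_idV _ _ _ _ F (hφ.1 (ι₁.vertexMap w) F)
  · exact isOpen_range_pi1Map_φE φ _ _ _ F (hφ.2 (ι₁.edgeMap e) F)

/-! ### The induced morphisms `𝒢[v] → ℋ[f v]`, `𝒢[e] → ℋ[f e]` (Def 4.1 (iv)) -/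

/-- **Def 4.1 (iv)**: the morphism `𝒢[v] → ℋ[f v]` induced by `φ : 𝒢 → ℋ` (over the induced
morphism of local semi-graphs `𝔾[v] → ℍ[f v]`). [cite: MochizukiSemiAnbd2006, Def 4.1 (iv), p. 51] -/
noncomputable def HomOver.atVertexMap (φ : HomOver 𝒢 ℋ f) (v : 𝒢.graph.Vertex) :
    Hom (𝒢.atVertex v) (ℋ.atVertex (f.vertexMap v)) :=
  (φ.inducedAlongSquare (𝒢.graph.atVertexHom v) (ℋ.graph.atVertexHom (f.vertexMap v))
    (SemiGraph.atVertexMap f v) (SemiGraph.atVertexMap_comp_atVertexHom f v).symm).toHom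

/-- **Def 4.1 (iv)**: the morphism `𝒢[e] → ℋ[f e]` induced by `φ : 𝒢 → ℋ`.
[cite: MochizukiSemiAnbd2006, Def 4.1 (iv), p. 51] -/
noncomputable def HomOver.atEdgeMap (φ : HomOver 𝒢 ℋ f) (e : 𝒢.graph.Edge) :
    Hom (𝒢.atEdge e) (ℋ.atEdge (f.edgeMap e)) :=
  (φ.inducedAlongSquare (𝒢.graph.atEdgeHom e) (ℋ.graph.atEdgeHom (f.edgeMap e))
    (SemiGraph.atEdgeMap f e) (SemiGraph.atEdgeMap_comp_atEdgeHom f e).symm).toHom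

/-- The underlying morphism of semi-graphs of `𝒢[v] → ℋ[f v]` is `𝔾[v] → ℍ[f v]`.
[cite: MochizukiSemiAnbd2006, Def 4.1 (iv), p. 51] -/
@[simp] theorem HomOver.atVertexMap_base (φ : HomOver 𝒢 ℋ f) (v : 𝒢.graph.Vertex) :
    (φ.atVertexMap v).base = SemiGraph.atVertexMap f v := rfl

/-- The underlying morphism of semi-graphs of `𝒢[e] → ℋ[f e]` is `𝔾[e] → ℍ[f e]`.
[cite: MochizukiSemiAnbd2006, Def 4.1 (iv), p. 51] -/
@[simp] theorem HomOver.atEdgeMap_base (φ : HomOver 𝒢 ℋ f) (e : 𝒢.graph.Edge) :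
    (φ.atEdgeMap e).base = SemiGraph.atEdgeMap f e := rfl

/-- `𝒢[v] → ℋ[f v]` is locally open when `φ` is. [cite: MochizukiSemiAnbd2006, Def 4.1 (iv), p. 51] -/
theorem HomOver.atVertexMap_isLocallyOpen (φ : HomOver 𝒢 ℋ f) (hφ : φ.toHom.IsLocallyOpen)
    (v : 𝒢.graph.Vertex) : (φ.atVertexMap v).IsLocallyOpen :=
  φ.inducedAlongSquare_isLocallyOpen _ _ _ _ hφ

/-- `𝒢[e] → ℋ[f e]` is locally open when `φ` is. [cite: MochizukiSemiAnbd2006, Def 4.1 (iv), p. 51] -/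
theorem HomOver.atEdgeMap_isLocallyOpen (φ : HomOver 𝒢 ℋ f) (hφ : φ.toHom.IsLocallyOpen)
    (e : 𝒢.graph.Edge) : (φ.atEdgeMap e).IsLocallyOpen :=
  φ.inducedAlongSquare_isLocallyOpen _ _ _ _ hφ

end SemiGraphOfAnabelioids

end Literature.AnabelianGeometry.SemiGraphs
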